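import Summits.CriticalPhenomena.PercolationContinuityZ3.Theorems.PercNearOneGluingNoHeavyQuantSGCLightPairPieces
import HarnessLib

/-!
# QUANT lane R8, T-DEC, cell L2 (`LawDec.SGCLightPair`), part 2: the POOLED two-copy partial flow and its dichotomy

builds on p205010 (kernel theorem, internal audit signed; external expert review pending)

Support file (`--supports stmt-CriticalPhenomena-4575`), QUANT lane seat prim-quant-arm-2 (gen 37), rung R8 of
`run/shared/lean/prim/quant/LADDER.md`.  One theorem, standard axioms, no sorries.  Uses part 1 (`…QuantSGCLightPairPieces`:
`lightPair_copy`, `usage_slot_le_shift`).  Memo `run/shared/lean/prim/quant/prim-quant-arm-2-g37/L2-TRANSPORT-G37.md` §5.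

SETTING.  Floor `0 < y < 1`, gate `0 < q`, weight `0 ≤ γ ≤ 1`; source target `S > 0`, increment `Δ ≤ 2·lo`, shifts `1 ≤ lo ≤ hi`; a law
`L` whose nonzero atoms are `L t = (1−γ)·[lo ≤ t]·q μ₁(t−lo) + γ·[hi ≤ t]·q μ₁(t−hi)` (the gated product `gate_q(μ₁ ∗ {lo,hi;γ})` off the
origin); product layer `j` with `hi ≤ j < M`, `M₁ + hi ≤ M`; flow witnesses `f₁`, `f₂` of `ν₁ = gate_q μ₁` at the source layers `j − lo`, `j − hi`
(target `S`).  The nonzero lows of `L` at `(S + Δ, j)` are shifted `ν₁`-lows of the two copies.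
THE PARTIAL FLOW `φ` (typer g26's `gatedShift_partial`, two sources, POOLED): the shifted mid pairs of both copies (weights `1−γ`, `γ`;
cheaper, `usage_copy_le`), plus the giant-bound masses `R = R₁ + R₂` of the nonzero lows (total `Q`) shipped proportionally into the POOLED slots
`slot = slot₁ + slot₂` (the images of the mids used by the gate zero of `ν₁` in `f₁`, `f₂`; total `z_mid`) — every displaced low rides every slot
at most at the rate the gate zero paid (`usage_slot_le_shift`, as all nonzero atoms of `L` are `≥ lo ≥ Δ/2`).  CONCLUSIONS (six conjuncts, the
shape of `gatedShift_partial`): `φ ≥ 0`; charged pairs are (nonzero low, admissible mid); `φ` vanishes off the nonzero lows / the columns `1..j`;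
every column is loaded by at most `L`; every nonzero low ships at most its mass; DICHOTOMY: either (`z_mid ≤ Q`) the unplaced low mass plus the
gate zero `1 − q` is at most what the two certified giant rooms absorb, `y/(1−y)·((1−q) + Σ_t (L t − Σ_k φ t k)) ≤ (1−γ)·Σ_{j−lo<h≤M₁} ν₁ h +
γ·Σ_{j−hi<h≤M₁} ν₁ h`, or (`Q < z_mid`) every nonzero low is fully placed.  Part 3 (`…QuantSGCLightPairLayer`) adds the remainder's flow.

[this work]; the one-copy construction: typer g26 (this lane).  The gluing rows served [cite: KozmaNitzan2024, Conjecture 3 (p. 15)]; product measure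
[cite: Grimmett1999, §1.3 p. 10].
-/

noncomputable section

namespace Summit.CriticalPhenomena.PercolationContinuityZ3.Theorems

namespace Quant

open Finset

namespace LawDec

/-- **THE POOLED TWO-COPY PARTIAL FLOW.**  See the file header. [this work] -/
theorem lightPair_partial (y S Δ q γ : ℝ) (j lo hi M₁ M : ℕ) (μ₁ L : ℕ → ℝ) (f₁ f₂ : ℕ → ℕ → ℝ)
    (hy0 : 0 < y) (hy1 : y < 1) (hq0 : 0 < q) (hγ0 : 0 ≤ γ) (hγ1 : γ ≤ 1) (hS : 0 < S) (hΔlo : Δ ≤ 2 * (lo : ℝ))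
    (hlo : 1 ≤ lo) (hlohi : lo ≤ hi) (hhij : hi ≤ j) (hjM : j < M) (hM : M₁ + hi ≤ M) (hμ0 : ∀ h, 0 ≤ μ₁ h)
    (hf₁ : IsFlowAtT y S (j - lo) M₁ (gate μ₁ q) f₁) (hf₂ : IsFlowAtT y S (j - hi) M₁ (gate μ₁ q) f₂)
    (hL : ∀ t, 1 ≤ t → L t = (1 - γ) * (if lo ≤ t then q * μ₁ (t - lo) else 0) + γ * (if hi ≤ t then q * μ₁ (t - hi) else 0)) :
    ∃ φ : ℕ → ℕ → ℝ,
      (∀ t k, 0 ≤ φ t k) ∧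
      (∀ t k, 0 < φ t k → t ≤ j ∧ 2 * (t : ℝ) < S + Δ ∧ k ≤ M ∧ (j + 1 ≤ k ∨ S + Δ < (t : ℝ) + k)) ∧
      (∀ t k, ¬ ((1 ≤ t ∧ t ≤ j ∧ 2 * (t : ℝ) < S + Δ) ∧ 1 ≤ k ∧ k ≤ j) → φ t k = 0) ∧
      (∀ k, 1 ≤ k → k ≤ j → ∑ t ∈ Finset.range (j + 1), usage y (S + Δ) j t k * φ t k ≤ L k) ∧
      (∀ t, (1 ≤ t ∧ t ≤ j ∧ 2 * (t : ℝ) < S + Δ) → ∑ k ∈ Finset.range (M + 1), φ t k ≤ L t) ∧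
      ((y / (1 - y) * ((1 - q) + ∑ t ∈ Finset.range (j + 1),
          (if (1 ≤ t ∧ t ≤ j ∧ 2 * (t : ℝ) < S + Δ) then L t - ∑ k ∈ Finset.range (M + 1), φ t k else 0))
          ≤ (1 - γ) * ∑ h ∈ Finset.Ico (j - lo + 1) (M₁ + 1), gate μ₁ q h
            + γ * ∑ h ∈ Finset.Ico (j - hi + 1) (M₁ + 1), gate μ₁ q h) ∨
       (∀ t, (1 ≤ t ∧ t ≤ j ∧ 2 * (t : ℝ) < S + Δ) → ∑ k ∈ Finset.range (M + 1), φ t k = L t)) := by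
  classical
  set S' : ℝ := S + Δ with hS'
  set uy : ℝ := y / (1 - y) with huy
  have h1y : 0 < 1 - y := by linarith
  have huy0 : 0 < uy := div_pos hy0 h1y
  have h1γ : 0 ≤ 1 - γ := by linarith
  have hΔhi : Δ ≤ 2 * (hi : ℝ) := le_trans hΔlo (by exact_mod_cast Nat.mul_le_mul_left 2 hlohi)
  have hνpos : ∀ h, 1 ≤ h → gate μ₁ q h = q * μ₁ h := fun h hh => by rw [gate_apply, if_neg (by omega)]; ring
  /- ### the pieces of the two copies -/
  obtain ⟨m₁, s₁, R₁, hm₁0, hs₁0, hR₁0, hm₁supp, hm₁z, hs₁supp, hs₁z, hcol₁, hcap₁, hrow₁, ⟨hR₁s, hR₁z⟩, -, -, -, hkey₁⟩ :=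
    lightPair_copy y S Δ q (1 - γ) (j - lo) lo j M₁ M μ₁ f₁ hy0 hy1 hq0 h1γ hS hΔlo hlo (by omega) (by omega) hjM hμ0 hf₁
  obtain ⟨m₂, s₂, R₂, hm₂0, hs₂0, hR₂0, hm₂supp, hm₂z, hs₂supp, hs₂z, hcol₂, hcap₂, hrow₂, ⟨hR₂s, hR₂z⟩, -, -, -, hkey₂⟩ :=
    lightPair_copy y S Δ q γ (j - hi) hi j M₁ M μ₁ f₂ hy0 hy1 hq0 hγ0 hS hΔhi (by omega) (by omega) hM hjM hμ0 hf₂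
  /- ### pooling -/
  set slot : ℕ → ℝ := fun k => s₁ k + s₂ k with hslot
  set R : ℕ → ℝ := fun t => R₁ t + R₂ t with hR
  set zmid : ℝ := ∑ k ∈ Finset.range (M + 1), slot k with hzmid
  set Q : ℝ := ∑ t ∈ Finset.range (j + 1), R t with hQ
  set D : ℝ := max Q zmid with hD
  set ρ : ℕ → ℝ := fun t => R t / D with hρ
  set φ : ℕ → ℕ → ℝ := fun t k =>
    m₁ t k + m₂ t k + (if (1 ≤ t ∧ t ≤ j ∧ 2 * (t : ℝ) < S') then ρ t * slot k else 0) with hφ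
  have hslot0 : ∀ k, 0 ≤ slot k := fun k => add_nonneg (hs₁0 k) (hs₂0 k)
  have hR0 : ∀ t, 0 ≤ R t := fun t => add_nonneg (hR₁0 t) (hR₂0 t)
  have hzmid0 : 0 ≤ zmid := Finset.sum_nonneg fun k _ => hslot0 k
  have hQ0 : 0 ≤ Q := Finset.sum_nonneg fun t _ => hR0 t
  have hQD : Q ≤ D := le_max_left _ _
  have hzD : zmid ≤ D := le_max_right _ _
  have hD0 : 0 ≤ D := le_trans hQ0 hQD
  have hρ0 : ∀ t, 0 ≤ ρ t := fun t => div_nonneg (hR0 t) hD0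
  -- where `R` (hence `ρ`) can be nonzero: nonzero lows of `L`, which are `≥ lo`
  have hRz : ∀ t, ¬ (1 ≤ t ∧ t ≤ j ∧ 2 * (t : ℝ) < S') → R t = 0 := by
    intro t ht
    have h1 : R₁ t = 0 := hR₁z t (fun hc => ht ⟨by omega, hc.2.1, hc.2.2⟩) (fun hc => ht ⟨by omega, by omega, hc.1 ▸ hc.2⟩)
    have h2 : R₂ t = 0 := hR₂z t (fun hc => ht ⟨by omega, hc.2.1, hc.2.2⟩) (fun hc => ht ⟨by omega, by omega, by
      have := hc.2; rw [hc.1]; exact lt_of_le_of_lt (by exact_mod_cast le_refl (2 * hi)) this⟩)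
    simp only [hR]; rw [h1, h2, add_zero]
  have hRlo : ∀ t, 0 < R t → lo ≤ t := by
    intro t hp
    by_contra hlt
    have h1 : R₁ t = 0 := hR₁z t (fun hc => hlt (by omega)) (fun hc => hlt (by omega))
    have h2 : R₂ t = 0 := hR₂z t (fun hc => hlt (by omega)) (fun hc => hlt (by omega))
    simp only [hR] at hp; rw [h1, h2, add_zero] at hp; exact lt_irrefl _ hp
  have hρz : ∀ t, ¬ (1 ≤ t ∧ t ≤ j ∧ 2 * (t : ℝ) < S') → ρ t = 0 := fun t ht => by
    simp only [hρ]; rw [hRz t ht, zero_div]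
  have hρsum : ∑ t ∈ Finset.range (j + 1), ρ t = Q / D := by simp only [hρ]; rw [← Finset.sum_div]
  have hQD1 : Q / D ≤ 1 := by
    rcases hD0.eq_or_lt with hz | hpos
    · rw [← hz, div_zero]; exact zero_le_one
    · exact (div_le_one hpos).2 hQD
  have hρsum1 : ∑ t ∈ Finset.range (j + 1), ρ t ≤ 1 := hρsum ▸ hQD1
  have hρz_le : ∀ t, ρ t * zmid ≤ R t := by
    intro t
    simp only [hρ]
    rcases hD0.eq_or_lt with hz | hpos
    · rw [← hz, div_zero, zero_mul]; exact hR0 t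
    · rw [div_mul_eq_mul_div, div_le_iff₀ hpos]
      exact mul_le_mul_of_nonneg_left hzD (hR0 t)
  /- ### `L` on a nonzero low splits along the copies -/
  have hL₁ : ∀ t, (1 ≤ t ∧ t ≤ j ∧ 2 * (t : ℝ) < S') →
      ∑ k ∈ Finset.range (M + 1), m₁ t k + R₁ t = (1 - γ) * (if lo ≤ t then q * μ₁ (t - lo) else 0) := by
    intro t ht
    by_cases h1 : lo + 1 ≤ t
    · rw [hrow₁ t ⟨h1, ht.2.1, ht.2.2⟩, if_pos (by omega)]
    · have hm : ∑ k ∈ Finset.range (M + 1), m₁ t k = 0 :=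
        Finset.sum_eq_zero fun k _ => hm₁z t k (fun hc => h1 hc.1.1)
      rw [hm, zero_add]
      by_cases h2 : t = lo
      · subst h2
        rw [hR₁s ht.2.2, if_pos le_rfl, Nat.sub_self]
      · rw [hR₁z t (fun hc => h1 hc.1) (fun hc => h2 hc.1), if_neg (by omega), mul_zero]
  have hL₂ : ∀ t, (1 ≤ t ∧ t ≤ j ∧ 2 * (t : ℝ) < S') →
      ∑ k ∈ Finset.range (M + 1), m₂ t k + R₂ t = γ * (if hi ≤ t then q * μ₁ (t - hi) else 0) := by
    intro t ht
    by_cases h1 : hi + 1 ≤ t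
    · rw [hrow₂ t ⟨h1, ht.2.1, ht.2.2⟩, if_pos (by omega)]
    · have hm : ∑ k ∈ Finset.range (M + 1), m₂ t k = 0 :=
        Finset.sum_eq_zero fun k _ => hm₂z t k (fun hc => h1 hc.1.1)
      rw [hm, zero_add]
      by_cases h2 : t = hi
      · subst h2
        rw [hR₂s ht.2.2, if_pos le_rfl, Nat.sub_self]
      · rw [hR₂z t (fun hc => h1 hc.1) (fun hc => h2 hc.1), if_neg (by omega), mul_zero]
  have hLt : ∀ t, (1 ≤ t ∧ t ≤ j ∧ 2 * (t : ℝ) < S') →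
      L t = (∑ k ∈ Finset.range (M + 1), m₁ t k + ∑ k ∈ Finset.range (M + 1), m₂ t k) + R t := by
    intro t ht
    rw [hL t ht.1, ← hL₁ t ht, ← hL₂ t ht]
    simp only [hR]; ring
  have hrowφ : ∀ t, (1 ≤ t ∧ t ≤ j ∧ 2 * (t : ℝ) < S') →
      L t - ∑ k ∈ Finset.range (M + 1), φ t k = R t - ρ t * zmid := by
    intro t ht
    have hsplit : ∑ k ∈ Finset.range (M + 1), φ t k
        = (∑ k ∈ Finset.range (M + 1), m₁ t k + ∑ k ∈ Finset.range (M + 1), m₂ t k) + ρ t * zmid := by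
      simp only [hφ]
      rw [Finset.sum_add_distrib, Finset.sum_add_distrib]
      simp only [if_pos ht]
      rw [← Finset.mul_sum]
    rw [hsplit, hLt t ht]; ring
  /- ### the six conjuncts -/
  have hφ0 : ∀ t k, 0 ≤ φ t k := fun t k => by
    simp only [hφ]
    refine add_nonneg (add_nonneg (hm₁0 t k) (hm₂0 t k)) ?_
    split_ifs
    · exact mul_nonneg (hρ0 t) (hslot0 k)
    · exact le_rfl
  -- what a charged slot term looks like
  have hslot_term : ∀ t k, 0 < (if (1 ≤ t ∧ t ≤ j ∧ 2 * (t : ℝ) < S') then ρ t * slot k else 0) →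
      (1 ≤ t ∧ t ≤ j ∧ 2 * (t : ℝ) < S') ∧ lo ≤ t ∧ 0 < slot k := by
    intro t k hp
    by_cases ht : (1 ≤ t ∧ t ≤ j ∧ 2 * (t : ℝ) < S')
    · rw [if_pos ht] at hp
      have hρp : 0 < ρ t := by
        rcases (hρ0 t).eq_or_lt with hz | hpos
        · rw [← hz, zero_mul] at hp; exact absurd hp (lt_irrefl 0)
        · exact hpos
      have hRp : 0 < R t := by
        simp only [hρ] at hρp
        rcases (hR0 t).eq_or_lt with hz | hpos
        · rw [← hz, zero_div] at hρp; exact absurd hρp (lt_irrefl 0)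
        · exact hpos
      have hsl : 0 < slot k := by
        rcases (hslot0 k).eq_or_lt with hz | hpos
        · rw [← hz, mul_zero] at hp; exact absurd hp (lt_irrefl 0)
        · exact hpos
      exact ⟨ht, hRlo t hRp, hsl⟩
    · rw [if_neg ht] at hp; exact absurd hp (lt_irrefl 0)
  have hslot_pos : ∀ k, 0 < slot k → lo + 1 ≤ k ∧ k ≤ j ∧
      ((0 < s₁ k ∧ lo + 1 ≤ k ∧ S < (((k - lo : ℕ)) : ℝ)) ∨ (0 < s₂ k ∧ hi + 1 ≤ k ∧ S < (((k - hi : ℕ)) : ℝ))) := by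
    intro k hp
    rcases (hs₁0 k).eq_or_lt with hz1 | hp1
    · have hp2 : 0 < s₂ k := by simp only [hslot] at hp; rw [← hz1, zero_add] at hp; exact hp
      obtain ⟨hk1, hkj, _, hSk⟩ := hs₂supp k hp2
      exact ⟨by omega, hkj, Or.inr ⟨hp2, hk1, hSk⟩⟩
    · obtain ⟨hk1, hkj, _, hSk⟩ := hs₁supp k hp1
      exact ⟨hk1, hkj, Or.inl ⟨hp1, hk1, hSk⟩⟩
  have hφsupp : ∀ t k, 0 < φ t k → t ≤ j ∧ 2 * (t : ℝ) < S' ∧ k ≤ M ∧ (j + 1 ≤ k ∨ S' < (t : ℝ) + k) := by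
    intro t k hp
    simp only [hφ] at hp
    by_cases hA : 0 < m₁ t k
    · obtain ⟨ht, _, hkj, _, hc⟩ := hm₁supp t k hA
      exact ⟨ht.2.1, ht.2.2, by omega, Or.inr hc⟩
    by_cases hB : 0 < m₂ t k
    · obtain ⟨ht, _, hkj, _, hc⟩ := hm₂supp t k hB
      exact ⟨ht.2.1, ht.2.2, by omega, Or.inr hc⟩
    have hA0 : m₁ t k = 0 := le_antisymm (not_lt.1 hA) (hm₁0 t k)
    have hB0 : m₂ t k = 0 := le_antisymm (not_lt.1 hB) (hm₂0 t k)
    rw [hA0, hB0, zero_add, zero_add] at hp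
    obtain ⟨ht, hlot, hsl⟩ := hslot_term t k hp
    obtain ⟨_, hkj, hcase⟩ := hslot_pos k hsl
    have hlot' : (lo : ℝ) ≤ t := by exact_mod_cast hlot
    have hhi' : (lo : ℝ) ≤ hi := by exact_mod_cast hlohi
    refine ⟨ht.2.1, ht.2.2, by omega, Or.inr ?_⟩
    rcases hcase with ⟨_, hklo, hSk⟩ | ⟨_, hkhi, hSk⟩
    · have ek : (((k - lo : ℕ)) : ℝ) = (k : ℝ) - lo := by push_cast [Nat.cast_sub (show lo ≤ k by omega)]; ring
      rw [ek] at hSk; rw [hS']; linarith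
    · have ek : (((k - hi : ℕ)) : ℝ) = (k : ℝ) - hi := by push_cast [Nat.cast_sub (show hi ≤ k by omega)]; ring
      rw [ek] at hSk; rw [hS']; linarith
  have hφz : ∀ t k, ¬ ((1 ≤ t ∧ t ≤ j ∧ 2 * (t : ℝ) < S') ∧ 1 ≤ k ∧ k ≤ j) → φ t k = 0 := by
    intro t k hn
    by_contra hne
    have hp : 0 < φ t k := lt_of_le_of_ne (hφ0 t k) (Ne.symm hne)
    simp only [hφ] at hp
    by_cases hA : 0 < m₁ t k
    · obtain ⟨ht, hk1, hkj, _, _⟩ := hm₁supp t k hA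
      exact hn ⟨⟨by omega, ht.2.1, ht.2.2⟩, by omega, hkj⟩
    by_cases hB : 0 < m₂ t k
    · obtain ⟨ht, hk1, hkj, _, _⟩ := hm₂supp t k hB
      exact hn ⟨⟨by omega, ht.2.1, ht.2.2⟩, by omega, hkj⟩
    have hA0 : m₁ t k = 0 := le_antisymm (not_lt.1 hA) (hm₁0 t k)
    have hB0 : m₂ t k = 0 := le_antisymm (not_lt.1 hB) (hm₂0 t k)
    rw [hA0, hB0, zero_add, zero_add] at hp
    obtain ⟨ht, _, hsl⟩ := hslot_term t k hp
    obtain ⟨hk1, hkj, _⟩ := hslot_pos k hsl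
    exact hn ⟨ht, by omega, hkj⟩
  have hcolφ : ∀ k, 1 ≤ k → k ≤ j → ∑ t ∈ Finset.range (j + 1), usage y S' j t k * φ t k ≤ L k := by
    intro k hk1 hkj
    -- the slot part of column `k`: every displaced low rides the slot at most at the zero's price
    have hslot₁ : ∑ t ∈ Finset.range (j + 1), usage y S' j t k *
        (if (1 ≤ t ∧ t ≤ j ∧ 2 * (t : ℝ) < S') then ρ t * s₁ k else 0) ≤ usage y S (j - lo) 0 (k - lo) * s₁ k := by
      rcases (hs₁0 k).eq_or_lt with hz | hsp
      · have : ∀ t ∈ Finset.range (j + 1), usage y S' j t k *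
            (if (1 ≤ t ∧ t ≤ j ∧ 2 * (t : ℝ) < S') then ρ t * s₁ k else 0) = 0 := by
          intro t _; rw [← hz]; split_ifs <;> simp
        rw [Finset.sum_eq_zero this, ← hz, mul_zero]
      · obtain ⟨hk1', hkj', _, hSk⟩ := hs₁supp k hsp
        refine slot_term_le y S' _ _ j k ρ _ hρ0 hρsum1 hsp.le
          (usage_zero_mid_nonneg y S (j - lo) (k - lo) hy0 hy1 hS hSk (by omega)) (fun t ht hρp => ?_)
        have hRp : 0 < R t := by
          simp only [hρ] at hρp
          rcases (hR0 t).eq_or_lt with hz | hpos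
          · rw [← hz, zero_div] at hρp; exact absurd hρp (lt_irrefl 0)
          · exact hpos
        have hlot : (lo : ℝ) ≤ t := by exact_mod_cast hRlo t hRp
        have e1 : j = (j - lo) + lo := by omega
        have e2 : k = (k - lo) + lo := by omega
        rw [hS', e1, e2]
        simp only [Nat.add_sub_cancel]
        exact usage_slot_le_shift y S Δ (j - lo) lo t (k - lo) hy0 hy1 hS hSk (by omega) (by linarith) hΔlo
          (by rw [← hS']; exact ht.2.2)
    have hslot₂ : ∑ t ∈ Finset.range (j + 1), usage y S' j t k *
        (if (1 ≤ t ∧ t ≤ j ∧ 2 * (t : ℝ) < S') then ρ t * s₂ k else 0) ≤ usage y S (j - hi) 0 (k - hi) * s₂ k := by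
      rcases (hs₂0 k).eq_or_lt with hz | hsp
      · have : ∀ t ∈ Finset.range (j + 1), usage y S' j t k *
            (if (1 ≤ t ∧ t ≤ j ∧ 2 * (t : ℝ) < S') then ρ t * s₂ k else 0) = 0 := by
          intro t _; rw [← hz]; split_ifs <;> simp
        rw [Finset.sum_eq_zero this, ← hz, mul_zero]
      · obtain ⟨hk1', hkj', _, hSk⟩ := hs₂supp k hsp
        refine slot_term_le y S' _ _ j k ρ _ hρ0 hρsum1 hsp.le
          (usage_zero_mid_nonneg y S (j - hi) (k - hi) hy0 hy1 hS hSk (by omega)) (fun t ht hρp => ?_)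
        have hRp : 0 < R t := by
          simp only [hρ] at hρp
          rcases (hR0 t).eq_or_lt with hz | hpos
          · rw [← hz, zero_div] at hρp; exact absurd hρp (lt_irrefl 0)
          · exact hpos
        have hlot : (lo : ℝ) ≤ t := by exact_mod_cast hRlo t hRp
        have e1 : j = (j - hi) + hi := by omega
        have e2 : k = (k - hi) + hi := by omega
        rw [hS', e1, e2]
        simp only [Nat.add_sub_cancel]
        exact usage_slot_le_shift y S Δ (j - hi) hi t (k - hi) hy0 hy1 hS hSk (by omega) (by linarith) hΔhi
          (by rw [← hS']; exact ht.2.2)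
    -- per copy: mid part + slot at the zero's price ≤ what the copy's column received, `≤` its share of `L k`
    have hcopy₁ : ∑ t ∈ Finset.range (j + 1), usage y S' j t k * m₁ t k + usage y S (j - lo) 0 (k - lo) * s₁ k
        ≤ (1 - γ) * (if lo ≤ k then q * μ₁ (k - lo) else 0) := by
      by_cases hk : lo + 1 ≤ k
      · refine le_trans (hcol₁ k hk hkj) (le_trans (hcap₁ k hk hkj) ?_)
        rw [if_pos (by omega), hνpos (k - lo) (by omega)]
      · have h1 : ∑ t ∈ Finset.range (j + 1), usage y S' j t k * m₁ t k = 0 :=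
          Finset.sum_eq_zero fun t _ => by rw [hm₁z t k (fun hc => hk hc.2.1), mul_zero]
        rw [h1, hs₁z k (fun hc => hk hc.1), mul_zero, zero_add]
        split_ifs
        · exact mul_nonneg h1γ (mul_nonneg hq0.le (hμ0 _))
        · simp
    have hcopy₂ : ∑ t ∈ Finset.range (j + 1), usage y S' j t k * m₂ t k + usage y S (j - hi) 0 (k - hi) * s₂ k
        ≤ γ * (if hi ≤ k then q * μ₁ (k - hi) else 0) := by
      by_cases hk : hi + 1 ≤ k
      · refine le_trans (hcol₂ k hk hkj) (le_trans (hcap₂ k hk hkj) ?_)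
        rw [if_pos (by omega), hνpos (k - hi) (by omega)]
      · have h1 : ∑ t ∈ Finset.range (j + 1), usage y S' j t k * m₂ t k = 0 :=
          Finset.sum_eq_zero fun t _ => by rw [hm₂z t k (fun hc => hk hc.2.1), mul_zero]
        rw [h1, hs₂z k (fun hc => hk hc.1), mul_zero, zero_add]
        split_ifs
        · exact mul_nonneg hγ0 (mul_nonneg hq0.le (hμ0 _))
        · simp
    have hsplit : ∑ t ∈ Finset.range (j + 1), usage y S' j t k * φ t k
        = (∑ t ∈ Finset.range (j + 1), usage y S' j t k * m₁ t k
            + ∑ t ∈ Finset.range (j + 1), usage y S' j t k *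
                (if (1 ≤ t ∧ t ≤ j ∧ 2 * (t : ℝ) < S') then ρ t * s₁ k else 0))
          + (∑ t ∈ Finset.range (j + 1), usage y S' j t k * m₂ t k
            + ∑ t ∈ Finset.range (j + 1), usage y S' j t k *
                (if (1 ≤ t ∧ t ≤ j ∧ 2 * (t : ℝ) < S') then ρ t * s₂ k else 0)) := by
      rw [← Finset.sum_add_distrib, ← Finset.sum_add_distrib, ← Finset.sum_add_distrib]
      refine Finset.sum_congr rfl fun t _ => ?_
      simp only [hφ, hslot]
      split_ifs <;> ring
    rw [hsplit, hL k hk1]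
    linarith [hslot₁, hslot₂, hcopy₁, hcopy₂]
  have hrows : ∀ t, (1 ≤ t ∧ t ≤ j ∧ 2 * (t : ℝ) < S') → ∑ k ∈ Finset.range (M + 1), φ t k ≤ L t := by
    intro t ht
    linarith [hrowφ t ht, hρz_le t]
  refine ⟨φ, hφ0, hφsupp, hφz, hcolφ, hrows, ?_⟩
  by_cases hcase : zmid ≤ Q
  · -- slots full: the unplaced mass plus the gate zero fits into the two certified giant rooms
    left
    have hlhs : ∑ t ∈ Finset.range (j + 1),
        (if (1 ≤ t ∧ t ≤ j ∧ 2 * (t : ℝ) < S') then L t - ∑ k ∈ Finset.range (M + 1), φ t k else 0) = Q - zmid := by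
      have e : ∀ t ∈ Finset.range (j + 1),
          (if (1 ≤ t ∧ t ≤ j ∧ 2 * (t : ℝ) < S') then L t - ∑ k ∈ Finset.range (M + 1), φ t k else 0)
            = R t - ρ t * zmid := by
        intro t _
        by_cases ht : (1 ≤ t ∧ t ≤ j ∧ 2 * (t : ℝ) < S')
        · rw [if_pos ht, hrowφ t ht]
        · rw [if_neg ht, hRz t ht, hρz t ht]; ring
      rw [Finset.sum_congr rfl e, Finset.sum_sub_distrib, ← Finset.sum_mul, ← hQ, hρsum]
      have hk : Q / D * zmid = zmid := by
        have hDQ : D = Q := max_eq_left hcase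
        rcases hQ0.eq_or_lt with hz | hpos
        · have hz0 : zmid = 0 := le_antisymm (by rw [hz]; exact hcase) hzmid0
          rw [hz0, mul_zero]
        · rw [hDQ, div_self (ne_of_gt hpos), one_mul]
      rw [hk]
    rw [hlhs]
    have hQsplit : Q = ∑ t ∈ Finset.range (j + 1), R₁ t + ∑ t ∈ Finset.range (j + 1), R₂ t := by
      rw [hQ]; simp only [hR]; rw [Finset.sum_add_distrib]
    have hzsplit : zmid = ∑ k ∈ Finset.range (M + 1), s₁ k + ∑ k ∈ Finset.range (M + 1), s₂ k := by
      rw [hzmid]; simp only [hslot]; rw [Finset.sum_add_distrib]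
    have e : uy * ((1 - q) + (Q - zmid))
        = uy * ((1 - γ) * (1 - q) + ∑ t ∈ Finset.range (j + 1), R₁ t - ∑ k ∈ Finset.range (M + 1), s₁ k)
          + uy * (γ * (1 - q) + ∑ t ∈ Finset.range (j + 1), R₂ t - ∑ k ∈ Finset.range (M + 1), s₂ k) := by
      rw [hQsplit, hzsplit]; ring
    rw [e]
    exact add_le_add hkey₁ hkey₂
  · -- `Q < z_mid`: every nonzero low is fully placed
    right
    have hQlt : Q < zmid := not_le.1 hcase
    have hzpos : 0 < zmid := lt_of_le_of_lt hQ0 hQlt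
    have hDz : D = zmid := max_eq_right hQlt.le
    intro t ht
    have h := hrowφ t ht
    have hρa : ρ t * zmid = R t := by
      simp only [hρ]; rw [hDz, div_mul_cancel₀ _ (ne_of_gt hzpos)]
    linarith


end LawDec

end Quant

end Summit.CriticalPhenomena.PercolationContinuityZ3.Theorems
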